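import Summits.ABC.IUTFork.Thm311LinkCompat
import Literature.IUT.LogThetaLattice.BiCores
import Literature.IUT.LogThetaLattice.HodgeTheaterLogLink
import HarnessLib

/-!
# [IUTchIII] Theorem 3.11 in the author's terms, J: the objects of (iii) over the landed §1–§2 interface

Record-only file (D-0012) of the abc-iut cell (Cor. 3.12 sub-crew, seat abc-iut-c312-1, gen 2); TAKES NO
SIDE. Sequel to `Thm311LinkCompat` (D), which typed [IUTchIII] Theorem 3.11 (iii) (kurims
`paper:url-4b091feeb646` pp. 156–159) over an opaque SIGNATURE `LinkData` (20 fields: the categories,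
objects, Kummer/natural isomorphisms, permutation-symmetry poly-isomorphisms and induced automorphisms
that (iii) (a)–(d) quote). Since then layer L6 (seat abc-iut-L6-t3) has LANDED the [IUTchIII] §1–§2
interface these objects come from: `Literature.IUT.LogThetaLattice.StripFrame` (the prime-strip /
Hodge-theater frame, [IUTchIII] Def. 1.1), `BiCoricData` (Def. 1.1 (iv)–(vi), Prop. 1.2 (vi)–(ix),
Thm. 1.5 (iii)–(v): the Frobenius-like `†HT ↦ †F^{⊢×μ}_△`, the étale-like `†HT^D ↦ †D^⊢_△ ↦ F^{⊢×μ}_△(†D^⊢_△)`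
and the Kummer isomorphism between them AS A NATURAL ISOMORPHISM `kummer : fxmDeltaHT ≅ (htToD ⋙ dvDelta)
⋙ fxmOfDv`), `LogThetaLatticeDiagram` (Def. 1.4 / Thm. 1.5 (i)(ii): `(n, m) ↦ ^{n,m}HT`, vertical and
horizontal arrows FULL poly-isomorphisms), `ThetaCoricData`/`Radial` (Cor. 2.3) and `ThetaMonoidData`
(Prop. 2.1 (vi): `unitPortionD`, the natural isomorphisms `F^{⊢×}_△(†D^⊢_△) ⥲ F^{⊢×}_{env}(†D_>)`).

## This file (top-down, one level): `LinkData` CONSTRUCTED, not postulated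

* `LinkData.ofFunctors` builds the objects of (iii) from: a lattice of Hodge theaters `H : ℤ × ℤ → S.HT`;
  for each vertical line a representative `D`-`Θ^{±ell}NF`-Hodge theater `^{n,∘}HT^D := Dl n` with
  identifications `ξ n m : D(^{n,m}HT) ≅ ^{n,∘}HT^D` (Thm. 3.11, p. 153: "`^{n,∘}HT^{D-Θ±ell NF}` … determined, up
  to isomorphism, by the various `^{n,m}HT^{Θ±ell NF}`, where `m ∈ ℤ`, via the vertical coricity of Theorem
  1.5, (i)" — the vertical arrows induce the FULL poly-isomorphism of `D`-Hodge theaters,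
  `LogThetaLatticeDiagram.vertical_inducedDHT_full`, so SOME identification exists and NONE is preferred;
  every theorem below holds for every choice of `ξ`); the Frobenius-like and étale-like `F^{⊢×μ}_△`
  FUNCTORS with the Kummer NATURAL isomorphism (Thm. 1.5 (iii), last display); the `F^{⊢×μ}_{env}` functor
  with the natural isomorphism of Prop. 2.1 (vi); and the radial data `^{n,∘}R` (Cor. 2.3 (ii)) and the
  `κ`-sol/`∞κ` data of [IUTchII] Cor. 4.7 (iii) as values of FUNCTORS on `D`-`Θ^{±ell}NF`-Hodge theaters
  (Cor. 2.3: "(b_{Morℜ}), (c_{Morℜ}) the isomorphisms INDUCED by" an isomorphism of `D`-Hodge theaters;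
  Rmk. 2.3.2: the `∞κ` version "is similar"). READING fixed here of "the poly-isomorphism `^{n,∘}R ⥲
  ^{n+1,∘}R` induced by any permutation symmetry of the étale-picture … `^{n,∘}HT^{D-Θ±ell NF} ⥲
  ^{n+1,∘}HT^{D-Θ±ell NF}`" ((iii) (c), p. 157; likewise (d), p. 158): the étale-picture "admits arbitrary
  permutation symmetries among the spokes [i.e., the labels `n ∈ ℤ` of the `D-Θ^{±ell}NF`-Hodge theaters]"
  ([IUTchII] Cor. 4.11 (ii), kurims `paper:url-5036b4059555` p. 164; [IUTchIII] Cor. 2.3 (ii) p. 74), the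
  spokes being glued to the mono-analytic core by the FULL poly-isomorphisms `^nD^⊢_△ ⥲ ^{(n+1)}D^⊢_△`
  ([IUTchII] Cor. 4.10 (iv), Cor. 4.11 (i)); no isomorphism `^{n,∘}HT^D ⥲ ^{n+1,∘}HT^D` being singled out, the
  induced poly-isomorphism is typed as the IMAGE under the functor of the FULL poly-isomorphism of
  `D`-`Θ^{±ell}NF`-Hodge theaters (`permR`, `permM`); under the only other reading we can see — ALL
  isomorphisms of radial data, cf. Cor. 2.3 (i) "full" (L6 `radialAlgorithm_full`) — the stabilization
  clause is D's `PolyIsoCalc.stabilized_full`/`LinkData.partIIIc_of_full`, so nothing below depends on the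
  choice between the two. "Arbitrary automorphisms of the domain and codomain
  `^{n,m}HT`, `^{n+1,m}HT` of the horizontal arrow" act on every object through the functors (`AutHT n m :=
  (^{n,m}HT ≅ ^{n,m}HT)`, transported to `^{n,∘}HT^D` along `ξ n m`).
* `LinkData.ofBiCoric` = `ofFunctors` with the `F^{⊢×μ}_△` functors and the Kummer natural isomorphism taken
  from an L6 `BiCoricData`; `LinkData.ofDiagram` = the same over an L6 `LogThetaLatticeDiagram`, with
  `^{n,∘}HT^D := D(^{n,0}HT)` and `ξ` a CHOICE of members of the vertical full poly-isomorphisms.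

## What the kernel then sees (bookkeeping, neutral)

D proved that (iii) (a), (b) AS TYPED hold in every instantiation (squares of full poly-isomorphisms
commute). Here: for `LinkData.ofFunctors`, (iii) (c) and (iii) (d) AS TYPED hold as well —
`ofFunctors_partIIIc`, `ofFunctors_partIIId`: the EQUIVARIANCE of the Kummer isomorphism `^{n,m}F^{⊢×μ}_△ ⥲
F^{⊢×μ}_△(^{n,∘}D^⊢_△)` under `Aut(^{n,m}HT)` IS the naturality square of `BiCoricData.kummer`
(`LinkData.kumAt_naturality`), and a poly-isomorphism that is the functorial image of a FULL poly-isomorphism is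
STABILIZED by all functorially induced automorphisms (`PolyIsoCalc.stabilized_map_full`). Consequently, for
a `FullSituation` whose `link` is so constructed, `PartIII ↔ EvalCompatUpToInd` and `Statement ↔ PartI ∧
PartII` (`FullSituation.statement_iff_partI_partII_of_link`): at this level of typing the content of
Theorem 3.11 is carried by (i) (`MultiradialCompat`, `DegreeClause`) and (ii) (`KummerA/B/C`, `Ind3`), the
link compatibility (iii) being functoriality. This is CONSISTENT WITH BOTH printed positions and decides
nothing between them: the author — "The various assertions of Theorem 3.11 follow immediately from the
definitions and the references quoted" (Proof, p. 159), "in the sense that these constructions are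
stabilized/equivariant/functorial" (pp. 158–159); LANA Rem. 8.2.1 (p. 42) — ""linked," in the sense that
there exists an isomorphism between them, is a vacuous assertion since the category of BPSs is a
connected groupoid". Whether the (Ind1)/(Ind2)/(Ind3)-transport of (i)/(ii) LICENSES the volume
comparison of Cor. 3.12 Step (xi) is untouched here (that is c312-2's `hLicOfThm` hypothesis).

Sources read on the page (own renders, keys per HOME/lit/SOURCES.md §11): [IUTchIII] pp. 153–159
(Thm. 3.11), p. 74 (Cor. 2.3 (ii)), pp. 114–115 (Rmk. 3.8.2); [IUTchII] pp. 160–161 (Cor. 4.10 (iv)(v)),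
pp. 163–164 (Cor. 4.11). [claim: Mochizuki2012, status: disputed] [cite: LANA2026Report, Rem. 8.2.1 p. 42]
Deliberately NOT here: any change to A–I (append-only, names frozen); the `F^{⊢×μ}_{env}` functor and the
`∞κ` data themselves (abc-iut-L6-t3 `ThetaMonoidData.unitPortionD`; abc-iut-L6-t1/L5 `κ`-coric files) —
they enter as arguments; mono-theta environments; any judgement.
-/

noncomputable section

namespace Summit.ABC

namespace IUTFork

namespace Thm311

open CategoryTheory
open Literature.IUT.HodgeTheaters (PolyIso)
open Literature.IUT.LogThetaLattice

/-! ## 1. One more line of poly-isomorphism calculus -/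

namespace PolyIsoCalc

universe v u v' u'

variable {C : Type u} [Category.{v} C] {D : Type u'} [Category.{v'} D]

/-- A poly-isomorphism that is the image under a functor `G` of a FULL poly-isomorphism `X ⥲ Y` is
STABILIZED by every pair of automorphisms that are themselves images under `G` of automorphisms of `X`,
`Y`: `G(α) ∘ G(ζ) ∘ G(β) = G(α ∘ ζ ∘ β)` is again the image of an isomorphism. This is the formal content of
"stabilized … with respect to arbitrary automorphisms of the domain and codomain" for functorially
INDUCED poly-isomorphisms. [folklore] -/
theorem stabilized_map_full (G : C ⥤ D) (X Y : C) (GX : Set (G.obj X ≅ G.obj X))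
    (GY : Set (G.obj Y ≅ G.obj Y)) (hX : ∀ a ∈ GX, ∃ α : X ≅ X, G.mapIso α = a)
    (hY : ∀ b ∈ GY, ∃ β : Y ≅ Y, G.mapIso β = b) :
    Stabilized ((PolyIso.full X Y).map G) GX GY := by
  intro a ha b hb f hf
  obtain ⟨α, rfl⟩ := hX a ha
  obtain ⟨β, rfl⟩ := hY b hb
  obtain ⟨ζ, -, rfl⟩ := PolyIso.mem_map.1 hf
  exact PolyIso.mem_map.2 ⟨α ≪≫ ζ ≪≫ β, PolyIso.mem_full _,
    by rw [Functor.mapIso_trans, Functor.mapIso_trans]⟩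

end PolyIsoCalc

/-! ## 2. The objects of (iii), constructed functorially over a lattice of Hodge theaters -/

namespace LinkData

variable {S : StripFrame.{0}}

/-- The Kummer isomorphism `†F^{⊢×μ}_△ ⥲ F^{⊢×μ}_△(†D^⊢_△)` at ONE Hodge theater `X` — the component at `X` of a
natural isomorphism `kum : Ffr ≅ D(−) ⋙ Fet` between the Frobenius-like and the étale-like `F^{⊢×μ}_△`
functors (Thm. 1.5 (iii), last display), with syntactically plain type (as L6's `BiCoricData.kummerAt`).
[claim: Mochizuki2012, status: disputed] -/
def kumAt (Ffr : S.HT ⥤ S.Fxm) (Fet : S.DHT ⥤ S.Fxm) (kum : Ffr ≅ S.htToD ⋙ Fet) (X : S.HT) :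
    Ffr.obj X ≅ Fet.obj (S.htToD.obj X) :=
  kum.app X

/-- NATURALITY of the Kummer isomorphism, as a commuting square of isomorphisms: for `a : X ⥲ X'`,
`Ffr(a)` followed by the Kummer isomorphism at `X'` equals the Kummer isomorphism at `X` followed by
`Fet(D(a))` ("compatible with the poly-isomorphisms of (ii)", Thm. 1.5 (iii) p. 50). [folklore] -/
theorem kumAt_naturality (Ffr : S.HT ⥤ S.Fxm) (Fet : S.DHT ⥤ S.Fxm) (kum : Ffr ≅ S.htToD ⋙ Fet)
    {X X' : S.HT} (a : X ≅ X') :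
    Ffr.mapIso a ≪≫ kumAt Ffr Fet kum X' = kumAt Ffr Fet kum X ≪≫ Fet.mapIso (S.htToD.mapIso a) := by
  ext
  exact kum.hom.naturality a.hom

/-- **The objects of [IUTchIII] Thm. 3.11 (iii), CONSTRUCTED** over a prime-strip/Hodge-theater frame `S`
(L6 `StripFrame`, [IUTchIII] Def. 1.1) from: the lattice `H : (n, m) ↦ ^{n,m}HT^{Θ±ell NF}` (Def. 1.4 /
3.8 (iii)); representatives `Dl n = ^{n,∘}HT^{D-Θ±ell NF}` of the vertical lines with identifications
`ξ n m : D(^{n,m}HT) ≅ ^{n,∘}HT^D` (Thm. 3.11 p. 153 "determined, up to isomorphism, … via the vertical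
coricity of Theorem 1.5, (i)"); the Frobenius-like `Ffr : †HT ↦ †F^{⊢×μ}_△` ([IUTchII] Cor. 4.10 (iv)) and
étale-like `Fet : †HT^D ↦ F^{⊢×μ}_△(†D^⊢_△)` (Thm. 1.5 (iii)) functors with the Kummer NATURAL isomorphism
`kum` (Thm. 1.5 (iii), last display; (iii) (a)); `Fenv : †HT^D ↦ F^{⊢×μ}_{env}(†D_>)` with the natural
isomorphism `nat` of Prop. 2.1 (vi) ((iii) (b)); the radial data `FR : †HT^D ↦ †ℜ` (Cor. 2.3; (iii) (c)) and
the `κ`-sol/`∞κ` data `FM` of [IUTchII] Cor. 4.7 (iii) ((iii) (d)) as functors. The permutation-symmetry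
poly-isomorphisms `^{n,∘}R ⥲ ^{n+1,∘}R`, `M_n ⥲ M_{n+1}` are the functorial images of the FULL
poly-isomorphism `^{n,∘}HT^D ⥲ ^{n+1,∘}HT^D` (reading fixed in the module docstring; [IUTchII] Cor. 4.11 (ii),
[IUTchIII] Cor. 2.3 (ii)); `Aut(^{n,m}HT)` acts on everything through the functors, on the `(n,∘)`-objects
after transport along `ξ n m`. [claim: Mochizuki2012, status: disputed] -/
def ofFunctors (H : ℤ × ℤ → S.HT) (Dl : ℤ → S.DHT) (ξ : ∀ n m : ℤ, S.htToD.obj (H (n, m)) ≅ Dl n)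
    (Ffr : S.HT ⥤ S.Fxm) (Fet : S.DHT ⥤ S.Fxm) (kum : Ffr ≅ S.htToD ⋙ Fet)
    (Fenv : S.DHT ⥤ S.Fxm) (nat : Fet ≅ Fenv)
    {Rad : Type} [Category.{0} Rad] (FR : S.DHT ⥤ Rad)
    {Kap : Type} [Category.{0} Kap] (FM : S.DHT ⥤ Kap) : LinkData where
  Strip := S.Fxm
  Fdelta n m := Ffr.obj (H (n, m))
  FdeltaD n := Fet.obj (Dl n)
  kumDelta n m := kumAt Ffr Fet kum (H (n, m)) ≪≫ Fet.mapIso (ξ n m)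
  FenvD n := Fenv.obj (Dl n)
  natEnvD n := nat.app (Dl n)
  Rad := Rad
  R n := FR.obj (Dl n)
  permR n := (PolyIso.full (Dl n) (Dl (n + 1))).map FR
  Kap := Kap
  Mk n := FM.obj (Dl n)
  permM n := (PolyIso.full (Dl n) (Dl (n + 1))).map FM
  AutHT n m := H (n, m) ≅ H (n, m)
  onDelta _ _ a := Ffr.mapIso a
  onDeltaD n m a := Fet.mapIso ((ξ n m).symm ≪≫ S.htToD.mapIso a ≪≫ ξ n m)
  onR n m a := FR.mapIso ((ξ n m).symm ≪≫ S.htToD.mapIso a ≪≫ ξ n m)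
  onM n m a := FM.mapIso ((ξ n m).symm ≪≫ S.htToD.mapIso a ≪≫ ξ n m)

section

variable (H : ℤ × ℤ → S.HT) (Dl : ℤ → S.DHT) (ξ : ∀ n m : ℤ, S.htToD.obj (H (n, m)) ≅ Dl n)
  (Ffr : S.HT ⥤ S.Fxm) (Fet : S.DHT ⥤ S.Fxm) (kum : Ffr ≅ S.htToD ⋙ Fet)
  (Fenv : S.DHT ⥤ S.Fxm) (nat : Fet ≅ Fenv)
  {Rad : Type} [Category.{0} Rad] (FR : S.DHT ⥤ Rad)
  {Kap : Type} [Category.{0} Kap] (FM : S.DHT ⥤ Kap)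

/-- The automorphism of `^{n,∘}HT^D` induced by an automorphism `a` of `^{n,m}HT`, transported along the
identification `ξ n m`. [folklore] -/
def autD (n m : ℤ) (a : H (n, m) ≅ H (n, m)) : Dl n ≅ Dl n := (ξ n m).symm ≪≫ S.htToD.mapIso a ≪≫ ξ n m

/-- The horizontal arrow of the constructed data is the full poly-isomorphism `^{n,m}F^{⊢×μ}_△ ⥲
^{n+1,m}F^{⊢×μ}_△` — as in D, and as [IUTchII] Cor. 4.10 (iv) / [IUTchIII] Thm. 1.5 (ii) print it ("coincides
with the full poly-isomorphism"; L6: `ThetaLinkData.linkInducedFxm_full`). [claim: Mochizuki2012, status: disputed] -/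
theorem ofFunctors_horizontal (n m : ℤ) :
    (ofFunctors H Dl ξ Ffr Fet kum Fenv nat FR FM).horizontal n m =
      PolyIso.full (Ffr.obj (H (n, m))) (Ffr.obj (H (n + 1, m))) := rfl

/-- **(iii) (c), equivariance clause, is Kummer NATURALITY**: the Kummer isomorphism `^{n,m}F^{⊢×μ}_△ ⥲
F^{⊢×μ}_△(^{n,∘}D^⊢_△)` of the constructed data intertwines the automorphism of `^{n,m}F^{⊢×μ}_△` induced by
`a ∈ Aut(^{n,m}HT)` with the automorphism of `F^{⊢×μ}_△(^{n,∘}D^⊢_△)` induced by `a` through `^{n,m}HT ↦ D(^{n,m}HT)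
≅ ^{n,∘}HT^D` — "compatible with the poly-isomorphisms of (ii)" (Thm. 1.5 (iii), p. 50).
[claim: Mochizuki2012, status: disputed] -/
theorem ofFunctors_kumDelta_equivariant (n m : ℤ) :
    PolyIsoCalc.Equivariant ((ofFunctors H Dl ξ Ffr Fet kum Fenv nat FR FM).kumDelta n m)
      {p | ∃ a : (ofFunctors H Dl ξ Ffr Fet kum Fenv nat FR FM).AutHT n m,
        p = ((ofFunctors H Dl ξ Ffr Fet kum Fenv nat FR FM).onDelta n m a,
          (ofFunctors H Dl ξ Ffr Fet kum Fenv nat FR FM).onDeltaD n m a)} := by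
  rintro p ⟨a, rfl⟩
  change H (n, m) ≅ H (n, m) at a
  change Ffr.mapIso a ≪≫ (kumAt Ffr Fet kum (H (n, m)) ≪≫ Fet.mapIso (ξ n m)) =
    (kumAt Ffr Fet kum (H (n, m)) ≪≫ Fet.mapIso (ξ n m)) ≪≫
      Fet.mapIso ((ξ n m).symm ≪≫ S.htToD.mapIso a ≪≫ ξ n m)
  rw [← Iso.trans_assoc, kumAt_naturality, Iso.trans_assoc, Iso.trans_assoc, ← Functor.mapIso_trans,
    ← Functor.mapIso_trans, Iso.self_symm_id_assoc]

/-- **(iii) (c) AS TYPED holds for the constructed data**: the Kummer isomorphism is equivariant (naturality)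
and the permutation-symmetry poly-isomorphism `^{n,∘}R ⥲ ^{n+1,∘}R`, being the functorial image of the FULL
poly-isomorphism of `D`-`Θ^{±ell}NF`-Hodge theaters, is stabilized by the functorially induced automorphisms —
"these constructions are stabilized/equivariant/functorial with respect to arbitrary automomorphisms of the
domain and codomain of these horizontal arrows" (p. 158). BOOKKEEPING, neutral. [folklore] -/
theorem ofFunctors_partIIIc : (ofFunctors H Dl ξ Ffr Fet kum Fenv nat FR FM).PartIIIc := by
  intro n m
  refine ⟨ofFunctors_kumDelta_equivariant H Dl ξ Ffr Fet kum Fenv nat FR FM n m, ?_⟩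
  refine PolyIsoCalc.stabilized_map_full FR (Dl n) (Dl (n + 1)) _ _ ?_ ?_
  · rintro a ⟨α, rfl⟩; exact ⟨autD H Dl ξ n m α, rfl⟩
  · rintro b ⟨β, rfl⟩; exact ⟨autD H Dl ξ (n + 1) m β, rfl⟩

/-- **(iii) (d) AS TYPED holds for the constructed data** (same mechanism for the `κ`-sol/`∞κ` data of
[IUTchII] Cor. 4.7 (iii)). BOOKKEEPING, neutral. [folklore] -/
theorem ofFunctors_partIIId : (ofFunctors H Dl ξ Ffr Fet kum Fenv nat FR FM).PartIIId := by
  intro n m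
  refine PolyIsoCalc.stabilized_map_full FM (Dl n) (Dl (n + 1)) _ _ ?_ ?_
  · rintro a ⟨α, rfl⟩; exact ⟨autD H Dl ξ n m α, rfl⟩
  · rintro b ⟨β, rfl⟩; exact ⟨autD H Dl ξ (n + 1) m β, rfl⟩

end

/-! ## 3. Over the landed L6 interface: `BiCoricData` and `LogThetaLatticeDiagram` -/

/-- **The objects of (iii) over an L6 `BiCoricData`** ([IUTchIII] Thm. 1.5 (iii), abc-iut-L6-t3
`Literature.IUT.LogThetaLattice.BiCoricData`): Frobenius-like `fxmDeltaHT : †HT ↦ †F^{⊢×μ}_△`, étale-like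
`dvDelta ⋙ fxmOfDv : †HT^D ↦ †D^⊢_△ ↦ F^{⊢×μ}_△(†D^⊢_△)`, and the Kummer isomorphisms "`^{n,m}F^{⊢×μ}_△ ⥲
F^{⊢×μ}_△(^{n,m}D^⊢_△)`" as the natural isomorphism `BiCoricData.kummer`. The remaining inputs (`F^{⊢×μ}_{env}`
with Prop. 2.1 (vi) — intended value abc-iut-L6-t3 `ThetaMonoidData.unitPortionD` composed with the
identification of its `fxmDeltaD` with `dvDelta ⋙ fxmOfDv`; radial data, Cor. 2.3; `∞κ` data, [IUTchII]
Cor. 4.7 (iii)) stay arguments. [claim: Mochizuki2012, status: disputed] -/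
def ofBiCoric (B : BiCoricData S) (H : ℤ × ℤ → S.HT) (Dl : ℤ → S.DHT)
    (ξ : ∀ n m : ℤ, S.htToD.obj (H (n, m)) ≅ Dl n) (Fenv : S.DHT ⥤ S.Fxm)
    (nat : B.dvDelta ⋙ B.fxmOfDv ≅ Fenv) {Rad : Type} [Category.{0} Rad] (FR : S.DHT ⥤ Rad)
    {Kap : Type} [Category.{0} Kap] (FM : S.DHT ⥤ Kap) : LinkData :=
  ofFunctors H Dl ξ B.fxmDeltaHT (B.dvDelta ⋙ B.fxmOfDv) B.kummer Fenv nat FR FM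

section

variable (B : BiCoricData S) (H : ℤ × ℤ → S.HT) (Dl : ℤ → S.DHT)
  (ξ : ∀ n m : ℤ, S.htToD.obj (H (n, m)) ≅ Dl n) (Fenv : S.DHT ⥤ S.Fxm)
  (nat : B.dvDelta ⋙ B.fxmOfDv ≅ Fenv) {Rad : Type} [Category.{0} Rad] (FR : S.DHT ⥤ Rad)
  {Kap : Type} [Category.{0} Kap] (FM : S.DHT ⥤ Kap)

/-- DICTIONARY: the Kummer isomorphism `^{n,m}F^{⊢×μ}_△ ⥲ F^{⊢×μ}_△(^{n,∘}D^⊢_△)` of (iii) (a) for the constructed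
data is L6's `BiCoricData.kummerAt (^{n,m}HT)` followed by the transport `F^{⊢×μ}_△(D^⊢_△(ξ n m))` to the
line representative — definitionally. [claim: Mochizuki2012, status: disputed] -/
theorem ofBiCoric_kumDelta (n m : ℤ) :
    (ofBiCoric B H Dl ξ Fenv nat FR FM).kumDelta n m =
      B.kummerAt (H (n, m)) ≪≫ B.fxmOfDv.mapIso (B.dvDelta.mapIso (ξ n m)) := rfl

/-- DICTIONARY: `^{n,m}F^{⊢×μ}_△` of the constructed data is L6's `B.fxmDeltaHT.obj (^{n,m}HT)` and
`F^{⊢×μ}_△(^{n,∘}D^⊢_△)` is `B.fxmDeltaOf (^{n,∘}HT^D)` — definitionally. [claim: Mochizuki2012, status: disputed] -/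
theorem ofBiCoric_fdeltaD (n : ℤ) : (ofBiCoric B H Dl ξ Fenv nat FR FM).FdeltaD n = B.fxmDeltaOf (Dl n) :=
  rfl

/-- (iii) (c) AS TYPED holds over any `BiCoricData` (Kummer naturality + functoriality). [folklore] -/
theorem ofBiCoric_partIIIc : (ofBiCoric B H Dl ξ Fenv nat FR FM).PartIIIc :=
  ofFunctors_partIIIc H Dl ξ _ _ _ Fenv nat FR FM

/-- (iii) (d) AS TYPED holds over any `BiCoricData`. [folklore] -/
theorem ofBiCoric_partIIId : (ofBiCoric B H Dl ξ Fenv nat FR FM).PartIIId :=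
  ofFunctors_partIIId H Dl ξ _ _ _ Fenv nat FR FM

end

/-- A CHOICE of identification `D(^{n,m}HT) ≅ D(^{n,0}HT)` inside the full poly-isomorphism induced by the
vertical arrows (Thm. 1.5 (i): "The vertical arrows … induce full poly-isomorphisms between the respective
associated `D-Θ^{±ell}NF`-Hodge theaters"; L6 `LogThetaLatticeDiagram.vertical_inducedDHT_full`; existence:
`StripFrame.iso_nonempty_DHT`). No member is preferred by the text; the theorems of this file hold for
every choice. [claim: Mochizuki2012, status: disputed] -/
def lineIso {L : LogStripData S} {T : ThetaLinkData S} (Λ : LogThetaLatticeDiagram L T) (n m : ℤ) :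
    S.htToD.obj (Λ.HT (n, m)) ≅ S.htToD.obj (Λ.HT (n, 0)) :=
  (S.iso_nonempty_DHT _ _).some

/-- The chosen identification is a member of the (full) poly-isomorphism of `D`-Hodge theaters induced by
the vertical arrows. [claim: Mochizuki2012, status: disputed] -/
theorem lineIso_mem_full {L : LogStripData S} {T : ThetaLinkData S} (Λ : LogThetaLatticeDiagram L T)
    (n m : ℤ) : lineIso Λ n m ∈ PolyIso.full _ _ :=
  PolyIso.mem_full _

/-- **The objects of (iii) over an L6 log-theta-lattice** `Λ : LogThetaLatticeDiagram L T` ([IUTchIII] Def. 1.4;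
for Thm. 3.11 an LGP-Gaussian one, Def. 3.8 (iii) — Rmk. 3.8.2: Thm. 1.5 / Cor. 2.3 "generalize immediately
[indeed, "formally"]") and a `BiCoricData`: `H := Λ.HT`, line representatives `^{n,∘}HT^D := D(^{n,0}HT)`
identified along `lineIso`. NOTE: L6 keeps two copies of `†HT ↦ †F^{⊢×μ}_△` (`ThetaLinkData.fxmDelta` in
`HodgeTheaterLogLink`, `BiCoricData.fxmDeltaHT` in `BiCores`, "repeated to keep imports at depth 1");
this constructor uses the latter, which carries the Kummer isomorphism. [claim: Mochizuki2012, status: disputed] -/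
def ofDiagram {L : LogStripData S} {T : ThetaLinkData S} (Λ : LogThetaLatticeDiagram L T)
    (B : BiCoricData S) (Fenv : S.DHT ⥤ S.Fxm) (nat : B.dvDelta ⋙ B.fxmOfDv ≅ Fenv)
    {Rad : Type} [Category.{0} Rad] (FR : S.DHT ⥤ Rad) {Kap : Type} [Category.{0} Kap]
    (FM : S.DHT ⥤ Kap) : LinkData :=
  ofBiCoric B Λ.HT (fun n => S.htToD.obj (Λ.HT (n, 0))) (lineIso Λ) Fenv nat FR FM

/-- (iii) (c) and (d) AS TYPED hold over any L6 log-theta-lattice and `BiCoricData`. [folklore] -/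
theorem ofDiagram_partIIIc_partIIId {L : LogStripData S} {T : ThetaLinkData S}
    (Λ : LogThetaLatticeDiagram L T) (B : BiCoricData S) (Fenv : S.DHT ⥤ S.Fxm)
    (nat : B.dvDelta ⋙ B.fxmOfDv ≅ Fenv) {Rad : Type} [Category.{0} Rad] (FR : S.DHT ⥤ Rad)
    {Kap : Type} [Category.{0} Kap] (FM : S.DHT ⥤ Kap) :
    (ofDiagram Λ B Fenv nat FR FM).PartIIIc ∧ (ofDiagram Λ B Fenv nat FR FM).PartIIId :=
  ⟨ofBiCoric_partIIIc B _ _ _ Fenv nat FR FM, ofBiCoric_partIIId B _ _ _ Fenv nat FR FM⟩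

end LinkData

/-! ## 4. Consequence for Theorem 3.11 as typed -/

namespace FullSituation

variable {T : ThetaIndex} (S : FullSituation T)

/-- If the link data satisfy (iii) (c), (d) — e.g. any `LinkData.ofFunctors` — then (iii) reduces to its
"up to (Ind1), (Ind2), (Ind3)" clause `EvalCompatUpToInd` ((iii) (a), (b) are automatic, D). [folklore] -/
theorem partIII_iff_evalCompat_of_link (hc : S.link.PartIIIc) (hd : S.link.PartIIId) :
    S.PartIII ↔ S.EvalCompatUpToInd :=
  ⟨fun h => h.2.2.2.2, fun h => ⟨S.link.partIIIa_holds, S.link.partIIIb_holds, hc, hd, h⟩⟩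

/-- **Theorem 3.11 as typed, when the objects of (iii) are functorial in the lattice**: `Statement ↔ (i) ∧
(ii)`. BOOKKEEPING (neutral): at this level the content sits in `MultiradialCompat`/`DegreeClause` (B) and
`KummerA/B/C`/`Ind3` (C); (iii) is functoriality plus a consequence of (i)
(`evalCompatUpToInd_of_multiradialCompat`, D). The author: Theorem 3.11's assertions "follow immediately from
the definitions" (p. 159). [folklore] -/
theorem statement_iff_partI_partII_of_link (hc : S.link.PartIIIc) (hd : S.link.PartIIId) :
    S.Statement ↔ S.PartI ∧ S.toLatticeSituation.PartII := by
  constructor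
  · exact fun h => ⟨h.1, h.2.1⟩
  · exact fun h => ⟨h.1, h.2, (S.partIII_iff_evalCompat_of_link hc hd).2
      (S.evalCompatUpToInd_of_multiradialCompat h.1.2.2)⟩

/-- The full situation whose (i)/(ii)-data are `S₀` and whose (iii)-objects are CONSTRUCTED by
`LinkData.ofFunctors`. [claim: Mochizuki2012, status: disputed] -/
def ofFunctors (S₀ : LatticeSituation T) {F : StripFrame.{0}} (H : ℤ × ℤ → F.HT) (Dl : ℤ → F.DHT)
    (ξ : ∀ n m : ℤ, F.htToD.obj (H (n, m)) ≅ Dl n) (Ffr : F.HT ⥤ F.Fxm) (Fet : F.DHT ⥤ F.Fxm)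
    (kum : Ffr ≅ F.htToD ⋙ Fet) (Fenv : F.DHT ⥤ F.Fxm) (nat : Fet ≅ Fenv)
    {Rad : Type} [Category.{0} Rad] (FR : F.DHT ⥤ Rad) {Kap : Type} [Category.{0} Kap]
    (FM : F.DHT ⥤ Kap) : FullSituation T :=
  { S₀ with link := LinkData.ofFunctors H Dl ξ Ffr Fet kum Fenv nat FR FM }

/-- **Theorem 3.11 as typed over functorially constructed (iii)-objects is (i) ∧ (ii).** [folklore] -/
theorem ofFunctors_statement_iff (S₀ : LatticeSituation T) {F : StripFrame.{0}} (H : ℤ × ℤ → F.HT)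
    (Dl : ℤ → F.DHT) (ξ : ∀ n m : ℤ, F.htToD.obj (H (n, m)) ≅ Dl n) (Ffr : F.HT ⥤ F.Fxm)
    (Fet : F.DHT ⥤ F.Fxm) (kum : Ffr ≅ F.htToD ⋙ Fet) (Fenv : F.DHT ⥤ F.Fxm) (nat : Fet ≅ Fenv)
    {Rad : Type} [Category.{0} Rad] (FR : F.DHT ⥤ Rad) {Kap : Type} [Category.{0} Kap]
    (FM : F.DHT ⥤ Kap) :
    (ofFunctors S₀ H Dl ξ Ffr Fet kum Fenv nat FR FM).Statement ↔ S₀.PartI ∧ S₀.PartII :=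
  (ofFunctors S₀ H Dl ξ Ffr Fet kum Fenv nat FR FM).statement_iff_partI_partII_of_link
    (LinkData.ofFunctors_partIIIc H Dl ξ Ffr Fet kum Fenv nat FR FM)
    (LinkData.ofFunctors_partIIId H Dl ξ Ffr Fet kum Fenv nat FR FM)

end FullSituation

end Thm311

end IUTFork

end Summit.ABC

end
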